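import Literature.MathematicalPhysics.QuantumFieldTheory.ConformalBootstrap3D.PointKernelK34L515.Cert

/-!
# K34L515 instance, cell `l6c8` (parts file: groups 0:28)

Kernel-v3 cell of the point-functional exclusion instance for the lower box `Δσ ∈ [0.515, 0.520]`,
`Δε ∈ [0.6, 0.95)` (certificate `certL515`, module `PointKernelK34L515.Cert`): spin `ℓ = 6`,
`Δ ∈ [121/16, 243/32)` (centre `A`, half-width `2^-6`), Taylor degree `3`, `n_F = 50`, `1` s-piece(s)
covering `s = Δσ ∈ [103/200, 13/25]`.  Group theorems `l6c8_part<i>_<a>_<b> : gPart … = some <literal>` are checked by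
`decide +kernel` (the literals were produced by `#eval` of the same function); the cell numbers `l6c8_num<i> ≥ 0`
likewise; `l6c8_block` is `PKTM.blockPositive_of_cellPass` applied to them. This file holds only group theorems (the cell stated as a literal); the final file of the cell imports it.  Generated by
`gen/mk_v3cell.py` / `gen/drive_v3.py` (typer-g8).  [folklore]
-/

set_option Elab.async false

namespace Literature.MathematicalPhysics.QuantumFieldTheory.ConformalBootstrap3D

namespace PointKernelK34L515

open PointKernel PKTM
open Literature.Analysis.ValidatedNumerics.PolyMP
open Literature.Analysis.ValidatedNumerics.NumericsMP

/-- group model literal [folklore] -/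
def l6c8_g0_28_34 : G3 := ([⟨491270323626712663214157957059442619338, 491270324622328708054903986417019715146⟩, ⟨16797181831658770886751687599780614155, 16797182530316864666459363046746085091⟩, ⟨3469696255529647263404286344933281755, 3469696945028171565089462974824704657⟩, ⟨1789684930569295635779471863025184131, 1789685519445672890125169515273917630⟩], [⟨-5784572947901962159319277333675504705, -5784572936710392783636980594587607712⟩, ⟨-252822266700269860225614775558070821, -252822258683993549923663855170660876⟩, ⟨-50414648544362393420009654403327419, -50414640610733349321126197787482735⟩, ⟨-17359574206694521687577261908337075, -17359567408160912627367928598874774⟩], [⟨35431389890801453190934839813129416, 35431389954717589501489732795844466⟩, ⟨1869448874773186393795669514153250, 1869448921103928649995839923002500⟩, ⟨312198907201733807389860631340519, 312198953192470062485045065232318⟩, ⟨95076806213569991643537622413982, 95076845761768864871034609789126⟩])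

/-- group `[28, 34)` of piece 0 [folklore] -/
theorem l6c8_part0_28_34 : gPart certL515 (⟨6, ((485 : ℚ) / 64), 6, 3, 50, 6, 64, ⟨3, 0, 5, 101, 0, 0⟩⟩ : TMCell) (pc ps1 0) 28 34 = some l6c8_g0_28_34 := by decide +kernel

end PointKernelK34L515

end Literature.MathematicalPhysics.QuantumFieldTheory.ConformalBootstrap3D
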